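import Mathlib.RingTheory.AlgebraicIndependent.AlgebraicClosure
import Mathlib.RingTheory.AlgebraicIndependent.Transcendental
import Mathlib.LinearAlgebra.Dimension.Free
import Literature.AnabelianGeometry.AbsoluteAnabelian.AbsTopIII.KummerFaithfulFGExtensionProofs
import Literature.AnabelianGeometry.AbsoluteAnabelian.AbsTopIII.KummerFaithfulPadicProofs
import Literature.AnabelianGeometry.AbsoluteAnabelian.AbsTopIII.KummerFaithfulNotSubpadicProofs
import Literature.FieldTheory.Regular.RacPurelyTranscendental
import HarnessLib

/-!
# [AbsTopIII] Rmk. 1.5.4 (iii), first conjunct, torus part: `ℚ_p(x_i)_{i ∈ I}` is torally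
Kummer-faithful — proof

Mochizuki, *Topics in Absolute Anabelian Geometry III*, §1, Remark 1.5.4 (iii), p. 34 of the
author's manuscript (lit key `paper:url-5493eb38cbb7`; journal pagination not held): "if [...]
`I` is an infinite set, then the field `k := ℚ_p(x_i)_{i ∈ I}` [...] constitutes an example of a
Kummer-faithful field which is not sub-`p`-adic. (Indeed, [...] Kummer-faithfulness follows from
Remark 1.5.4 (ii), together with the fact that any finitely generated extension of `k` is contained
in a finitely generated extension of some `ℚ_p(x_i)_{i ∈ J}` for `J ⊆ I` finite, over which `k` is
purely transcendental.)"

This PROOF-ONLY companion of `AbsTopIII/KummerFaithful.lean` (statements by abc-iut-L4-t1,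
p404026) proves the TORUS part of the first conjunct of the named fact `Rmk_1_5_4_iii` there, in
the generality the printed argument gives:

* `IsTorallyKummerFaithful.fractionRing_mvPolynomial` — a purely transcendental extension
  `k(x_i)_{i ∈ I}` (ANY index type `I`) of a torally Kummer-faithful field `k` is torally
  Kummer-faithful;
* `Rmk_1_5_4_iii_torally` — `ℚ_p(x_i)_{i ∈ I}` is torally Kummer-faithful (with
  `isTorallyKummerFaithful_padic`, companion `KummerFaithfulPadicProofs`, abc-iut-L4-d2 p405947);
* `Rmk_1_5_4_iii_of_abelianVariety_clause_of_not_isSubpadic` — the named fact `Rmk_1_5_4_iii`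
  reduced to its two residual inputs: the abelian-variety clause of `IsKummerFaithful` for these
  fields (no abelian varieties over them are in reach of the tree) and the second conjunct
  "not sub-`p`-adic" (companion `KummerFaithfulNotSubpadicProofs`, abc-iut-L4-d2).

## Proof (the printed parenthesis, made explicit)

Let `k'` be a finite extension of `K = k(x_i)_{i ∈ I}` and `u ∈ k'^×` with an `N`-th root in `k'`
for every `N ≥ 1`.  Choose a `K`-basis `b` of `k'`; the (finitely many) coefficients of algebraic
equations of the `b_m` over `K` and the coordinates of `u` in the basis `b` involve only finitely
many variables `x_j`, `j ∈ J`.  Put `E_J := k(x_J)(b) ⊆ k'`: a finitely generated extension of `k`,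
hence torally Kummer-faithful by Rmk. 1.5.4 (ii) (`Rmk_1_5_4_ii_holds`), containing `u`.  The
remaining variables `x_{I ∖ J}` are algebraically independent over `E_J` (Mathlib:
`AlgebraicIndependent.adjoin_of_disjoint`, `extendScalars` along the algebraic extension
`E_J / k(x_J)`) and generate `k'` over `E_J`, i.e. `k' = E_J(x_{I ∖ J})` is purely transcendental
over `E_J`; hence `E_J` is relatively algebraically closed in `k'` (tree:
`Literature.FieldTheory.Regular.mem_of_isAlgebraic_of_mem_adjoin_of_algebraicIndependent`), so
every `N`-th root of `u` lies in `E_J`, and `u = 1` there.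

No new definitions.  Nothing here bears on the disputed parts of IUT; this is a kernel check of an
elementary statement about multiplicative groups of purely transcendental field extensions.
-/

noncomputable section

open scoped Classical IntermediateField.algebraAdjoinAdjoin
open Polynomial

namespace Literature.AnabelianGeometry.AbsoluteAnabelian.AbsTopIII

universe u

section Helpers

variable {k : Type*} {E : Type*} [Field k] [Field E] [Algebra k E]

/-- An element algebraic over an intermediate field `F` is a root of a nonzero polynomial over the
big field all of whose coefficients lie in `F`. [cite: MochizukiAbsTopIII2015, Rmk 1.5.4 (iii) p.34] -/
private theorem exists_poly_of_isAlgebraic (F : IntermediateField k E) {a : E}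
    (ha : IsAlgebraic F a) :
    ∃ P : E[X], P ≠ 0 ∧ (∀ n, P.coeff n ∈ F) ∧ P.IsRoot a := by
  obtain ⟨p, hp0, hpa⟩ := ha
  refine ⟨p.map (algebraMap F E), ?_, fun n => ?_, ?_⟩
  · exact fun h => hp0 ((Polynomial.map_eq_zero_iff (algebraMap F E).injective).mp h)
  · rw [Polynomial.coeff_map]
    exact (p.coeff n).2
  · rw [Polynomial.IsRoot.def, Polynomial.eval_map, ← Polynomial.aeval_def]
    exact hpa

/-- Conversely, a root of a nonzero polynomial with coefficients in the intermediate field `F` is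
algebraic over `F`. [cite: MochizukiAbsTopIII2015, Rmk 1.5.4 (iii) p.34] -/
private theorem isAlgebraic_of_poly (F : IntermediateField k E) {a : E} (P : E[X]) (hP0 : P ≠ 0)
    (hcoef : ∀ n, P.coeff n ∈ F) (hroot : P.IsRoot a) : IsAlgebraic F a := by
  have hl : P ∈ Polynomial.lifts (algebraMap F E) :=
    (Polynomial.lifts_iff_coeff_lifts P).mpr fun n => ⟨⟨P.coeff n, hcoef n⟩, rfl⟩
  obtain ⟨q, hq⟩ := (Polynomial.mem_lifts P).mp hl
  refine ⟨q, ?_, ?_⟩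
  · rintro rfl
    exact hP0 (by rw [← hq, Polynomial.map_zero])
  · rw [Polynomial.aeval_def, ← Polynomial.eval_map, hq]
    exact hroot

end Helpers

/-- **Key step** (the parenthesis of [AbsTopIII] Rmk. 1.5.4 (iii) p. 34, for a general torally
Kummer-faithful ground field `k`): if `E ⊇ k` is a FINITE extension of `k(z_i)_{i ∈ I}` for a
family `z` algebraically independent over `k` (any index type `I`), then `⋂_N (E^×)^N = {1}`.
Descent to `E_J = k(z_J)(b)` (`J` finite, `b` a basis), which is finitely generated over `k`
(Rmk. 1.5.4 (ii)) and relatively algebraically closed in the purely transcendental `E = E_J(z_{I∖J})`.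
[cite: MochizukiAbsTopIII2015, Rmk 1.5.4 (iii) p.34] -/
theorem divisibleElementsTrivial_units_of_finite_adjoin_algebraicIndependent
    {k E : Type u} [Field k] [Field E] [Algebra k E] (hk : IsTorallyKummerFaithful k)
    {I : Type*} (z : I → E) (hz : AlgebraicIndependent k z)
    [Module.Finite (IntermediateField.adjoin k (Set.range z)) E] :
    DivisibleElementsTrivial Eˣ := by
  classical
  haveI : CharZero k := hk.charZero
  haveI : CharZero E := charZero_of_injective_algebraMap (algebraMap k E).injective
  set FI : IntermediateField k E := IntermediateField.adjoin k (Set.range z) with hFI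
  refine ⟨fun u hu => ?_⟩
  -- a basis of `E` over `FI = k(z_I)`; algebraic equations of its members; coordinates of `u`
  let b := Module.finBasis FI E
  have hbalg : ∀ m, ∃ P : E[X], P ≠ 0 ∧ (∀ n, P.coeff n ∈ FI) ∧ P.IsRoot (b m) := fun m =>
    exists_poly_of_isAlgebraic FI (Algebra.IsAlgebraic.isAlgebraic (b m))
  choose P hP0 hPcoef hProot using hbalg
  have hT : ∀ m n, ∃ T : Finset E, (T : Set E) ⊆ Set.range z ∧
      (P m).coeff n ∈ IntermediateField.adjoin k (T : Set E) := fun m n =>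
    IntermediateField.exists_finset_of_mem_adjoin (hPcoef m n)
  choose T hTsub hTmem using hT
  have hT' : ∀ m, ∃ T' : Finset E, (T' : Set E) ⊆ Set.range z ∧
      ((b.repr (u : E) m : FI) : E) ∈ IntermediateField.adjoin k (T' : Set E) := fun m =>
    IntermediateField.exists_finset_of_mem_adjoin (b.repr (u : E) m).2
  choose T' hT'sub hT'mem using hT'
  -- the finitely many variables involved
  let S₀ : Finset E := Finset.univ.biUnion fun m => ((P m).support.biUnion (T m)) ∪ T' m
  have hS₀sub : (S₀ : Set E) ⊆ Set.range z := by
    intro e he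
    rw [Finset.mem_coe] at he
    obtain ⟨m, -, hm⟩ := Finset.mem_biUnion.mp he
    rcases Finset.mem_union.mp hm with h | h
    · obtain ⟨n, -, hn⟩ := Finset.mem_biUnion.mp h
      exact hTsub m n hn
    · exact hT'sub m h
  have hTS : ∀ m, ∀ n ∈ (P m).support, (T m n : Set E) ⊆ S₀ := fun m n hn e he => by
    rw [Finset.mem_coe] at he ⊢
    exact Finset.mem_biUnion.mpr
      ⟨m, Finset.mem_univ m, Finset.mem_union_left _ (Finset.mem_biUnion.mpr ⟨n, hn, he⟩)⟩
  have hT'S : ∀ m, (T' m : Set E) ⊆ S₀ := fun m e he => by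
    rw [Finset.mem_coe] at he ⊢
    exact Finset.mem_biUnion.mpr ⟨m, Finset.mem_univ m, Finset.mem_union_right _ he⟩
  -- the finite set of indices `s` ("`J`") and the field `FJ = k(z_J)`
  let s : Set I := z ⁻¹' (S₀ : Set E)
  have hzs : z '' s = (S₀ : Set E) := Set.image_preimage_eq_of_subset hS₀sub
  set FJ : IntermediateField k E := IntermediateField.adjoin k (z '' s) with hFJ
  have hmemFJ : ∀ {X : Finset E}, (X : Set E) ⊆ S₀ → ∀ {e : E},
      e ∈ IntermediateField.adjoin k (X : Set E) → e ∈ FJ := fun hX e he => by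
    rw [hFJ, hzs]
    exact IntermediateField.adjoin.mono k _ _ hX he
  have hPcoefJ : ∀ m n, (P m).coeff n ∈ FJ := by
    intro m n
    by_cases hn : n ∈ (P m).support
    · exact hmemFJ (hTS m n hn) (hTmem m n)
    · rw [Polynomial.notMem_support_iff.mp hn]
      exact zero_mem _
  have hreprJ : ∀ m, ((b.repr (u : E) m : FI) : E) ∈ FJ := fun m =>
    hmemFJ (hT'S m) (hT'mem m)
  have hbalgJ : ∀ m, IsAlgebraic FJ (b m) := fun m =>
    isAlgebraic_of_poly FJ (P m) (hP0 m) (hPcoefJ m) (hProot m)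
  -- the field `EJ = k(z_J)(b)`, as an intermediate field of `E/k`
  set EJ : IntermediateField k E :=
    (IntermediateField.adjoin FJ (Set.range b)).restrictScalars k with hEJ
  have hFJ_EJ : FJ ≤ EJ := fun e he =>
    (IntermediateField.adjoin FJ (Set.range b)).algebraMap_mem ⟨e, he⟩
  have hb_EJ : ∀ m, b m ∈ EJ := fun m =>
    IntermediateField.subset_adjoin FJ (Set.range b) ⟨m, rfl⟩
  have hu_EJ : (u : E) ∈ EJ := by
    rw [← b.sum_repr (u : E)]
    refine sum_mem fun m _ => ?_
    rw [Algebra.smul_def]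
    exact mul_mem (hFJ_EJ (hreprJ m)) (hb_EJ m)
  -- `EJ` is algebraic over `FJ`
  letI : Algebra FJ EJ := (IntermediateField.inclusion hFJ_EJ).toRingHom.toAlgebra
  haveI : IsScalarTower FJ EJ E := IsScalarTower.of_algebraMap_eq (fun _ => rfl)
  haveI hEJalg₀ : Algebra.IsAlgebraic FJ (IntermediateField.adjoin FJ (Set.range b)) :=
    IntermediateField.isAlgebraic_adjoin (fun x hx => by
      obtain ⟨m, rfl⟩ := hx
      exact (hbalgJ m).isIntegral)
  haveI : Algebra.IsAlgebraic FJ EJ := ⟨fun y => by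
    have hy : (y : E) ∈ IntermediateField.adjoin FJ (Set.range b) := y.2
    have hyE : IsAlgebraic FJ (y : E) :=
      (isAlgebraic_algHom_iff (IntermediateField.adjoin FJ (Set.range b)).val
        Subtype.val_injective).mpr (hEJalg₀.isAlgebraic ⟨(y : E), hy⟩)
    exact (isAlgebraic_algHom_iff (IsScalarTower.toAlgHom FJ EJ E) Subtype.val_injective).mp hyE⟩
  -- the remaining variables are algebraically independent over `EJ` ...
  have hzT : AlgebraicIndependent EJ (fun i : ↥sᶜ => z i) := by
    have h1 : AlgebraicIndependent (Algebra.adjoin k (z '' s)) (fun i : ↥sᶜ => z i) :=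
      hz.adjoin_of_disjoint disjoint_compl_right
    have h2 : AlgebraicIndependent FJ (fun i : ↥sᶜ => z i) :=
      IntermediateField.algebraicIndependent_adjoin_iff.mpr h1
    exact h2.extendScalars EJ
  -- ... and generate `E` over `EJ`
  have htop : IntermediateField.adjoin EJ (Set.range fun i : ↥sᶜ => z i) = ⊤ := by
    rw [eq_top_iff]
    intro e _
    rw [← b.sum_repr e]
    refine sum_mem fun m _ => ?_
    rw [Algebra.smul_def]
    refine mul_mem ?_ ((IntermediateField.adjoin EJ _).algebraMap_mem ⟨b m, hb_EJ m⟩)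
    have hFI_le : FI ≤ (IntermediateField.adjoin EJ (Set.range fun i : ↥sᶜ => z i)).restrictScalars k := by
      rw [hFI]
      refine IntermediateField.adjoin_le_iff.mpr ?_
      rintro _ ⟨i, rfl⟩
      by_cases hi : i ∈ s
      · have hzi : z i ∈ EJ := hFJ_EJ (IntermediateField.subset_adjoin k (z '' s) ⟨i, hi, rfl⟩)
        exact (IntermediateField.adjoin EJ _).algebraMap_mem ⟨z i, hzi⟩
      · exact IntermediateField.subset_adjoin EJ _ ⟨⟨i, hi⟩, rfl⟩
    exact hFI_le (b.repr e m).2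
  -- `EJ` is relatively algebraically closed in `E = EJ(z_{I ∖ J})`
  have hrac : ∀ y : E, IsAlgebraic EJ y → y ∈ EJ := by
    intro y hy
    have hytop : y ∈ IntermediateField.adjoin EJ (Set.range fun i : ↥sᶜ => z i) := by
      rw [htop]
      exact IntermediateField.mem_top
    obtain ⟨T₀, hT₀sub, hyT₀⟩ := IntermediateField.exists_finset_of_mem_adjoin hytop
    haveI : Fintype (↥(T₀ : Set E)) := T₀.finite_toSet.fintype
    have ht : AlgebraicIndependent EJ ((↑) : ↥(T₀ : Set E) → E) :=
      hzT.to_subtype_range.mono hT₀sub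
    refine Literature.FieldTheory.Regular.mem_of_isAlgebraic_of_mem_adjoin_of_algebraicIndependent
      (F₀ := k) EJ ((↑) : ↥(T₀ : Set E) → E) ht ?_ hy
    rwa [Subtype.range_coe]
  -- `EJ` is finitely generated over `k`, hence torally Kummer-faithful (Rmk. 1.5.4 (ii))
  have hEJ_eq : EJ = IntermediateField.adjoin k (z '' s ∪ Set.range b) :=
    IntermediateField.adjoin_adjoin_left k (z '' s) (Set.range b)
  have hEJ_fg : EJ.FG := by
    rw [hEJ_eq]
    refine IntermediateField.fg_adjoin_of_finite (Set.Finite.union ?_ (Set.finite_range _))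
    rw [hzs]
    exact S₀.finite_toSet
  haveI : Algebra.EssFiniteType k EJ := IntermediateField.essFiniteType_iff.mpr hEJ_fg
  have hEJ_tkf : IsTorallyKummerFaithful EJ :=
    Rmk_1_5_4_ii_holds k EJ (IntermediateField.fg_top k EJ) hk
  have hEJ_div : DivisibleElementsTrivial (EJ)ˣ := hEJ_tkf.units EJ (Module.Finite.self EJ)
  -- conclusion: `u` is infinitely divisible inside `EJ^×`
  have hu0 : (⟨(u : E), hu_EJ⟩ : EJ) ≠ 0 := fun h => u.ne_zero (congrArg Subtype.val h)
  have key : Units.mk0 (⟨(u : E), hu_EJ⟩ : EJ) hu0 = 1 := by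
    refine hEJ_div.eq_one_of_forall_exists_pow _ fun n hn => ?_
    obtain ⟨y, hy⟩ := hu n hn
    have hyn : (y : E) ^ n = u := by rw [← Units.val_pow_eq_pow_val, hy]
    have halg : IsAlgebraic EJ ((y : E) ^ n) := by
      rw [hyn]
      exact isAlgebraic_algebraMap (⟨(u : E), hu_EJ⟩ : EJ)
    have hyEJ : (y : E) ∈ EJ := hrac _ (IsAlgebraic.of_pow hn halg)
    refine ⟨Units.mk0 ⟨(y : E), hyEJ⟩ (fun h => y.ne_zero (congrArg Subtype.val h)), ?_⟩
    apply Units.ext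
    apply Subtype.ext
    simp [hyn]
  have hu1 : (u : E) = 1 := by
    have := congrArg (fun w : (EJ)ˣ => ((w : EJ) : E)) key
    simpa using this
  exact Units.val_eq_one.mp hu1

/-- **Purely transcendental extensions of torally Kummer-faithful fields are torally
Kummer-faithful** ([AbsTopIII] Rmk. 1.5.4 (iii) p. 34, the printed parenthesis, for a general
torally Kummer-faithful `k` in place of `ℚ_p`): for ANY index type `I`, the rational function
field `k(x_i)_{i ∈ I} = Frac k[x_i]_{i ∈ I}` is torally Kummer-faithful.
[cite: MochizukiAbsTopIII2015, Rmk 1.5.4 (iii) p.34] -/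
theorem IsTorallyKummerFaithful.fractionRing_mvPolynomial {k : Type u} [Field k]
    (hk : IsTorallyKummerFaithful k) (I : Type u) :
    IsTorallyKummerFaithful (FractionRing (MvPolynomial I k)) := by
  haveI : CharZero k := hk.charZero
  haveI : CharZero (FractionRing (MvPolynomial I k)) :=
    charZero_of_injective_algebraMap (algebraMap k (FractionRing (MvPolynomial I k))).injective
  refine ⟨inferInstance, fun E _ _ hfin => ?_⟩
  haveI := hfin
  letI : Algebra k E :=
    ((algebraMap (FractionRing (MvPolynomial I k)) E).comp
      (algebraMap k (FractionRing (MvPolynomial I k)))).toAlgebra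
  haveI : IsScalarTower k (FractionRing (MvPolynomial I k)) E :=
    IsScalarTower.of_algebraMap_eq (fun _ => rfl)
  -- the variables, viewed in `E`
  let θ : MvPolynomial I k →ₐ[k] E :=
    (IsScalarTower.toAlgHom k (FractionRing (MvPolynomial I k)) E).comp
      (IsScalarTower.toAlgHom k (MvPolynomial I k) (FractionRing (MvPolynomial I k)))
  have hθapply : ∀ a, θ a = algebraMap (FractionRing (MvPolynomial I k)) E
      (algebraMap (MvPolynomial I k) (FractionRing (MvPolynomial I k)) a) := fun _ => rfl
  have hθ : Function.Injective θ := by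
    intro a c h
    rw [hθapply, hθapply] at h
    exact IsFractionRing.injective (MvPolynomial I k) (FractionRing (MvPolynomial I k))
      ((algebraMap (FractionRing (MvPolynomial I k)) E).injective h)
  let z : I → E := fun i => θ (MvPolynomial.X i)
  have haeval : MvPolynomial.aeval z = θ :=
    MvPolynomial.algHom_ext fun i => by simp [z]
  have hz : AlgebraicIndependent k z := by
    rw [algebraicIndependent_iff_injective_aeval, haeval]
    exact hθ
  -- `E` is finite over `k(z_I) ⊇ image of K`
  have hθmem : ∀ a : MvPolynomial I k, θ a ∈ IntermediateField.adjoin k (Set.range z) := fun a => by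
    have h1 : θ a ∈ Algebra.adjoin k (Set.range z) := by
      rw [Algebra.adjoin_range_eq_range_aeval, haeval]
      exact ⟨a, rfl⟩
    exact IntermediateField.algebra_adjoin_le_adjoin k _ h1
  have hKmem : ∀ x : FractionRing (MvPolynomial I k),
      algebraMap (FractionRing (MvPolynomial I k)) E x ∈ IntermediateField.adjoin k (Set.range z) := by
    intro x
    obtain ⟨a, c, -, rfl⟩ := IsFractionRing.div_surjective (A := MvPolynomial I k) x
    rw [map_div₀, ← hθapply, ← hθapply]
    exact div_mem (hθmem a) (hθmem c)
  letI : Algebra (FractionRing (MvPolynomial I k)) (IntermediateField.adjoin k (Set.range z)) :=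
    ((algebraMap (FractionRing (MvPolynomial I k)) E).codRestrict
      (IntermediateField.adjoin k (Set.range z)) hKmem).toAlgebra
  haveI : IsScalarTower (FractionRing (MvPolynomial I k))
      (IntermediateField.adjoin k (Set.range z)) E :=
    IsScalarTower.of_algebraMap_eq (fun _ => rfl)
  haveI : Module.Finite (IntermediateField.adjoin k (Set.range z)) E :=
    Module.Finite.of_restrictScalars_finite (FractionRing (MvPolynomial I k)) _ E
  exact divisibleElementsTrivial_units_of_finite_adjoin_algebraicIndependent hk z hz

/-- **[AbsTopIII] Rmk. 1.5.4 (iii), first conjunct, TORUS part**: for every prime `p` and every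
index type `I` (finite or infinite), the field `ℚ_p(x_i)_{i ∈ I}` is torally Kummer-faithful
("Kummer-faithfulness follows from Remark 1.5.4, (ii), together with the fact that any finitely
generated extension of `k` is contained in a finitely generated extension of some
`ℚ_p(x_i)_{i ∈ J}` for `J ⊆ I` finite, over which `k` is purely transcendental", p. 34; base case
`isTorallyKummerFaithful_padic`). [cite: MochizukiAbsTopIII2015, Rmk 1.5.4 (iii) p.34] -/
theorem Rmk_1_5_4_iii_torally (p : ℕ) [Fact p.Prime] (I : Type) :
    IsTorallyKummerFaithful (FractionRing (MvPolynomial I ℚ_[p])) :=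
  (isTorallyKummerFaithful_padic p).fractionRing_mvPolynomial I

open Literature.AlgebraicGeometry.Motives in
/-- **[AbsTopIII] Rmk. 1.5.4 (iii) reduced to its residual inputs**: the named fact `Rmk_1_5_4_iii`
follows from (1) the abelian-variety clause of `IsKummerFaithful` for the fields
`ℚ_p(x_i)_{i ∈ I}` (condition (a) of Def. 1.5 p. 32 for abelian varieties over their finite
extensions — the tree has no abelian varieties over these fields to argue with) and (2) the second
conjunct "not sub-`p`-adic" (companion `KummerFaithfulNotSubpadicProofs`); the torus clause is
`Rmk_1_5_4_iii_torally`. [cite: MochizukiAbsTopIII2015, Rmk 1.5.4 (iii) p.34] -/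
theorem Rmk_1_5_4_iii_of_abelianVariety_clause_of_not_isSubpadic
    (hAV : ∀ (p : ℕ) [Fact p.Prime] (I : Type) [Infinite I] (k' : Type) [Field k']
      [Algebra (FractionRing (MvPolynomial I ℚ_[p])) k'],
      Module.Finite (FractionRing (MvPolynomial I ℚ_[p])) k' →
        ∀ A : AbelianVariety k', DivisibleElementsTrivial (A.Points k'))
    (hns : ∀ (p : ℕ) [Fact p.Prime] (I : Type) [Infinite I],
      ¬ IsSubpadic (FractionRing (MvPolynomial I ℚ_[p]))) :
    Rmk_1_5_4_iii := fun p _ I _ =>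
  ⟨⟨Rmk_1_5_4_iii_torally p I, fun k' _ _ hfin A => hAV p I k' hfin A⟩, hns p I⟩

open Literature.AlgebraicGeometry.Motives in
/-- **[AbsTopIII] Rmk. 1.5.4 (iii) with ONE residual input** — the abelian-variety clause of
`IsKummerFaithful` for the fields `ℚ_p(x_i)_{i ∈ I}` (`I` infinite): the torus clause is
`Rmk_1_5_4_iii_torally` (this file) and the second conjunct "not sub-`p`-adic" is
`not_isSubpadic_fractionRing_mvPolynomial` (companion `KummerFaithfulNotSubpadicProofs`,
abc-iut-L4-d2), both PROVED. [cite: MochizukiAbsTopIII2015, Rmk 1.5.4 (iii) p.34] -/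
theorem Rmk_1_5_4_iii_of_abelianVariety_clause
    (hAV : ∀ (p : ℕ) [Fact p.Prime] (I : Type) [Infinite I] (k' : Type) [Field k']
      [Algebra (FractionRing (MvPolynomial I ℚ_[p])) k'],
      Module.Finite (FractionRing (MvPolynomial I ℚ_[p])) k' →
        ∀ A : AbelianVariety k', DivisibleElementsTrivial (A.Points k')) :
    Rmk_1_5_4_iii :=
  Rmk_1_5_4_iii_of_abelianVariety_clause_of_not_isSubpadic hAV
    fun p _ I _ => not_isSubpadic_fractionRing_mvPolynomial p I

end Literature.AnabelianGeometry.AbsoluteAnabelian.AbsTopIII
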